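import Summits.CriticalPhenomena.PercolationContinuityZ3.Theses.PercNearOneGluing
import Literature.Probability.LatticeModels.ProdBernoulliCoupling
import Literature.Probability.LatticeModels.ProdBernoulliIndependence
import HarnessLib

/-!
# `NoHeavyLowerTail` (stmt-CriticalPhenomena-4575) — compression moves for the one-cut functional

Support file for the crux `Summit.CriticalPhenomena.PercolationContinuityZ3.Theses.PercNearOneGluing.NoHeavyLowerTail`
(≡ `…Theses.PercNearOneGluingNoHeavy.NoHeavyLowerTail`), line `one-cut-symmetrisation` (route task nh7-symmetrise).
No definitions, no named facts, no sorries.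

Setting: bond percolation `μ = prodBernoulli w` with arbitrary edge probabilities on `Fin n`, a relay set `A`,
an observer `o`; `N_o(ω) = |{a ∈ A : o ↔ a}|`, `EN_o = Σ_{a ∈ A} μ(o ↔ a)`; for a ratio `ρ ≥ 0` the LOWER-TAIL
EVENT `B_ρ(o) = {1 ≤ N_o ∧ N_o < ρ · EN_o}` (the crux uses `ρ = δ/ε`, the one-cut engine `ρ = 1/2`).  The
one-cut engine conjecture (`Theorems.noHeavyLowerTail_of_oneCut`, `…_of_oneCut_const`) bounds `μ B_ρ` by the
worst pairwise cut `max_{a ≠ a'} μ(a ↮ a')`, with equality on the two-blob template.  A SYMMETRISATION proof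
needs moves on `(w, A, o)` that do not decrease `μ B_ρ` and do not increase any pairwise cut.  This file PROVES
three such moves (the census in the crux notes shows that the naive ones — contracting an edge, absorbing a
pendant blob, merging twin blobs — are NOT monotone, because a contraction raises `N` on minority
configurations):

* `lowerTail_observerTransfer` — ROOT THINNING: if almost surely `o ↔ a ⇒ o ↔ h` for every relay `a`
  (e.g. `h` is a cut vertex between `o` and `A`), then `N_o ∈ {0, N_h}` pointwise, so
  `μ B_ρ(o) ≤ μ B_ρ(h)`; the pairwise cuts do not involve the observer.
* `lowerTail_heavyRaise` — HEAVY SATURATION: call a vertex `u` HEAVY if `μ(o ↔ u, N_o < ρ EN_o) = 0`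
  (reaching `u` forces a majority).  Raising the weights of any set of edges both of whose endpoints are
  heavy does not decrease `μ B_ρ` (monotone label coupling: on `B_ρ` the cluster of `o` avoids every heavy
  vertex, so the added edges never touch it, while `EN` only grows) and does not increase any pairwise cut
  (`pairCut_anti`).  Hence WLOG all heavy vertices span ONE weight-one clique.
* `lowerTail_heavyClone` — HEAVY CLONING: adding to `A` a vertex almost surely glued to a heavy relay does
  not decrease `μ B_ρ` and keeps the worst pairwise cut (`pairCut_insert_le`).  Hence the mass of the heavy
  clique may be sent to infinity, where `B_ρ` becomes `{o ↮ H} ∩ {o ↔ A ∖ H}`: on configurations with a heavy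
  vertex the one-cut bound is event-form gluing against the saturated heavy clique
  (cf. `Theorems.oneCut_of_blobs_majority_of_eventGluing`).

The terminal two-blob identity is in `…OneCutSymmTerminal.lean`.

## References
* G. Kozma, S. Nitzan, arXiv:2401.12397 (2024), Conjecture 3. [KozmaNitzan2024]
* A. K. Kelmans, Acta Math. Acad. Sci. Hungar. 37 (1981) 77–88 (graph transformations monotone for
  connectivity probabilities — nearest prior art for the method, not used). [folklore]
-/

noncomputable section

namespace Summit.CriticalPhenomena.PercolationContinuityZ3.Theorems

open MeasureTheory Set Literature.Probability.LatticeModels Literature.Probability.Percolation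
open scoped Classical BigOperators

namespace OneCutSymm

variable {n : ℕ}

/-! ## A frozen cluster does not feel new edges -/

/-- **Frozen cluster.**  If every edge of `G'` which is not an edge of `G` has its endpoints outside
the `G`-cluster of `o`, then `G'`-walks starting inside that cluster stay inside it. [folklore] -/
theorem reachable_of_frozen {V : Type*} {G G' : SimpleGraph V} {o : V}
    (hnew : ∀ x y, G'.Adj x y → ¬ G.Adj x y → ¬ G.Reachable o x) :
    ∀ {x a : V}, G'.Walk x a → G.Reachable o x → G.Reachable o a
  | _, _, SimpleGraph.Walk.nil, hx => hx
  | x, _, SimpleGraph.Walk.cons (v := y) hadj p, hx => by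
      by_cases h : G.Adj x y
      · exact reachable_of_frozen hnew p (hx.trans h.reachable)
      · exact absurd hx (hnew x y hadj h)

/-! ## Root thinning: observer transfer -/

/-- **Observer transfer (root thinning).**  If almost surely `o ↔ a ⇒ o ↔ h` for every relay `a ∈ A`,
then `N_o ∈ {0, N_h}` off a null set and `EN_o ≤ EN_h`, so the lower-tail mass seen from `o` is at most
the one seen from `h`, for every ratio `ρ ≥ 0`.  (Typical use: `o ∉ A` and `h` a cut vertex separating
`o` from `A`; then WLOG the observer is `h`.) [folklore] -/
theorem lowerTail_observerTransfer (w : Sym2 (Fin n) → unitInterval) (A : Finset (Fin n))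
    (o h : Fin n) (ρ : ℝ) (hρ : 0 ≤ ρ)
    (hsep : ∀ a ∈ A, (prodBernoulli w).real (openConn o a ∩ (openConn o h)ᶜ) = 0) :
    (prodBernoulli w).real {ω : BondConfig (Fin n) |
        1 ≤ (A.filter fun a => ω ∈ openConn o a).card ∧
        ((A.filter fun a => ω ∈ openConn o a).card : ℝ) <
          ρ * ∑ a ∈ A, (prodBernoulli w).real (openConn o a)} ≤
    (prodBernoulli w).real {ω : BondConfig (Fin n) |
        1 ≤ (A.filter fun a => ω ∈ openConn h a).card ∧
        ((A.filter fun a => ω ∈ openConn h a).card : ℝ) <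
          ρ * ∑ a ∈ A, (prodBernoulli w).real (openConn h a)} := by
  classical
  set μ := prodBernoulli w with hμ
  set ENo := ∑ a ∈ A, μ.real (openConn o a) with hENo
  set ENh := ∑ a ∈ A, μ.real (openConn h a) with hENh
  -- the means compare termwise
  have hEN : ENo ≤ ENh := by
    refine Finset.sum_le_sum fun a ha => ?_
    calc μ.real (openConn o a)
        ≤ μ.real (openConn o a ∩ openConn o h ∪ openConn o a ∩ (openConn o h)ᶜ) :=
          measureReal_mono fun ω hω => by
            by_cases h' : ω ∈ openConn o h
            · exact Or.inl ⟨hω, h'⟩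
            · exact Or.inr ⟨hω, h'⟩
      _ ≤ μ.real (openConn o a ∩ openConn o h) + μ.real (openConn o a ∩ (openConn o h)ᶜ) :=
          measureReal_union_le _ _
      _ ≤ μ.real (openConn h a) + 0 := by
          rw [hsep a ha]
          refine add_le_add (measureReal_mono fun ω hω => ?_) le_rfl
          exact hω.2.symm.trans hω.1
      _ = μ.real (openConn h a) := add_zero _
  -- the exceptional set is null
  set Z := ⋃ a ∈ A, (openConn o a ∩ (openConn o h)ᶜ : Set (BondConfig (Fin n))) with hZ
  have hZ0 : μ.real Z = 0 :=
    le_antisymm ((measureReal_biUnion_finset_le _ _).trans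
      (le_of_eq (Finset.sum_eq_zero fun a ha => hsep a ha))) measureReal_nonneg
  -- off `Z`, the event seen from `o` lies in the event seen from `h`
  have hsub : {ω : BondConfig (Fin n) |
        1 ≤ (A.filter fun a => ω ∈ openConn o a).card ∧
        ((A.filter fun a => ω ∈ openConn o a).card : ℝ) < ρ * ENo} ⊆
      {ω : BondConfig (Fin n) |
        1 ≤ (A.filter fun a => ω ∈ openConn h a).card ∧
        ((A.filter fun a => ω ∈ openConn h a).card : ℝ) < ρ * ENh} ∪ Z := by
    intro ω hω
    by_cases hωZ : ω ∈ Z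
    · exact Or.inr hωZ
    refine Or.inl ?_
    obtain ⟨h1, hlt⟩ := hω
    -- some relay is reached from `o`, hence `o ↔ h`
    obtain ⟨a, ha⟩ := Finset.card_pos.1 h1
    obtain ⟨haA, hoa⟩ := Finset.mem_filter.1 ha
    have hoh : ω ∈ openConn o h := by
      by_contra hnot
      exact hωZ (Set.mem_biUnion haA ⟨hoa, hnot⟩)
    have heq : (A.filter fun a => ω ∈ openConn o a) = (A.filter fun a => ω ∈ openConn h a) := by
      refine Finset.filter_congr fun a _ => ⟨fun hoa' => ?_, fun hha => ?_⟩
      · exact (show (openGraph ω).Reachable o h from hoh).symm.trans hoa'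
      · exact (show (openGraph ω).Reachable o h from hoh).trans hha
    refine ⟨by rw [← heq]; exact h1, ?_⟩
    rw [← heq]
    exact lt_of_lt_of_le hlt (mul_le_mul_of_nonneg_left hEN hρ)
  calc μ.real {ω : BondConfig (Fin n) |
          1 ≤ (A.filter fun a => ω ∈ openConn o a).card ∧
          ((A.filter fun a => ω ∈ openConn o a).card : ℝ) < ρ * ENo}
      ≤ μ.real ({ω : BondConfig (Fin n) |
          1 ≤ (A.filter fun a => ω ∈ openConn h a).card ∧
          ((A.filter fun a => ω ∈ openConn h a).card : ℝ) < ρ * ENh} ∪ Z) := measureReal_mono hsub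
    _ ≤ μ.real {ω : BondConfig (Fin n) |
          1 ≤ (A.filter fun a => ω ∈ openConn h a).card ∧
          ((A.filter fun a => ω ∈ openConn h a).card : ℝ) < ρ * ENh} + μ.real Z :=
        measureReal_union_le _ _
    _ = _ := by rw [hZ0, add_zero]

/-! ## Heavy saturation -/

/-- Raising edge weights cannot increase a pairwise cut: `{a ↔ a'}` is increasing. [folklore] -/
theorem pairCut_anti (w w' : Sym2 (Fin n) → unitInterval) (hle : ∀ e, w e ≤ w' e) (a a' : Fin n) :
    (prodBernoulli w').real (openConn a a')ᶜ ≤ (prodBernoulli w).real (openConn a a')ᶜ := by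
  rw [probReal_compl_eq_one_sub MeasurableSet.of_discrete,
    probReal_compl_eq_one_sub MeasurableSet.of_discrete]
  have := prodBernoulli_real_mono_of_isUpperSet (p := w) (q := w') (fun e => hle e)
    (isUpperSet_openConn a a') MeasurableSet.of_discrete
  linarith

/-- **Heavy saturation.**  Let `H` be a set of HEAVY vertices for `(w, A, o, ρ)`:
`μ_w(o ↔ u, N_o < ρ EN_o) = 0` for `u ∈ H`.  If `w ≤ w'` edgewise and `w, w'` differ only on edges with
both endpoints in `H`, then `μ_w B_ρ ≤ μ_{w'} B'_ρ` (each side with its own mean).  Proof: monotone label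
coupling `η_w ⊆ η_{w'}`; on `B_ρ` the `η_w`-cluster of `o` avoids `H`, the extra edges of `η_{w'}` lie
inside `H`, so the cluster of `o` — hence `N` — is unchanged (`reachable_of_frozen`), and `EN_w ≤ EN_{w'}`.
[folklore] -/
theorem lowerTail_heavyRaise (w w' : Sym2 (Fin n) → unitInterval) (A : Finset (Fin n)) (o : Fin n)
    (ρ : ℝ) (hρ : 0 ≤ ρ) (H : Finset (Fin n))
    (hle : ∀ e, w e ≤ w' e)
    (hdiff : ∀ e, w e ≠ w' e → ∀ u ∈ e, u ∈ H)
    (hH : ∀ u ∈ H, (prodBernoulli w).real (openConn o u ∩ {ω : BondConfig (Fin n) |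
        ((A.filter fun a => ω ∈ openConn o a).card : ℝ) <
          ρ * ∑ a ∈ A, (prodBernoulli w).real (openConn o a)}) = 0) :
    (prodBernoulli w).real {ω : BondConfig (Fin n) |
        1 ≤ (A.filter fun a => ω ∈ openConn o a).card ∧
        ((A.filter fun a => ω ∈ openConn o a).card : ℝ) <
          ρ * ∑ a ∈ A, (prodBernoulli w).real (openConn o a)} ≤
    (prodBernoulli w').real {ω : BondConfig (Fin n) |
        1 ≤ (A.filter fun a => ω ∈ openConn o a).card ∧
        ((A.filter fun a => ω ∈ openConn o a).card : ℝ) <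
          ρ * ∑ a ∈ A, (prodBernoulli w').real (openConn o a)} := by
  classical
  set EN := ∑ a ∈ A, (prodBernoulli w).real (openConn o a) with hEN
  set EN' := ∑ a ∈ A, (prodBernoulli w').real (openConn o a) with hEN'
  have hww : w ≤ w' := fun e => hle e
  have hENle : EN ≤ EN' :=
    Finset.sum_le_sum fun a _ =>
      prodBernoulli_real_mono_of_isUpperSet hww (isUpperSet_openConn o a) MeasurableSet.of_discrete
  set B := {ω : BondConfig (Fin n) | 1 ≤ (A.filter fun a => ω ∈ openConn o a).card ∧
      ((A.filter fun a => ω ∈ openConn o a).card : ℝ) < ρ * EN} with hB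
  set B' := {ω : BondConfig (Fin n) | 1 ≤ (A.filter fun a => ω ∈ openConn o a).card ∧
      ((A.filter fun a => ω ∈ openConn o a).card : ℝ) < ρ * EN'} with hB'
  set Z := ⋃ u ∈ H, (openConn o u ∩ {ω : BondConfig (Fin n) |
      ((A.filter fun a => ω ∈ openConn o a).card : ℝ) < ρ * EN}) with hZ
  have hZ0 : (prodBernoulli w).real Z = 0 :=
    le_antisymm ((measureReal_biUnion_finset_le _ _).trans
      (le_of_eq (Finset.sum_eq_zero fun u hu => hH u hu))) measureReal_nonneg
  -- the label coupling
  have hprob : IsProbabilityMeasure ((volume : Measure ℝ).restrict (Set.Icc (0 : ℝ) 1)) :=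
    ⟨by simp [Real.volume_Icc]⟩
  set Λ : Measure (Sym2 (Fin n) → ℝ) :=
    Measure.infinitePi fun _ : Sym2 (Fin n) => (volume : Measure ℝ).restrict (Set.Icc (0 : ℝ) 1)
    with hΛ
  have hmeas : ∀ r : Sym2 (Fin n) → unitInterval,
      Measurable fun U : Sym2 (Fin n) → ℝ => {i | U i ≤ (r i : ℝ)} :=
    fun r => measurable_set_iff.2 fun i =>
      (show Measurable fun t : ℝ => (t ≤ (r i : ℝ)) from
        measurableSet_setOf.1 measurableSet_Iic).comp (measurable_pi_apply i)
  have hrepr : ∀ (r : Sym2 (Fin n) → unitInterval) (S : Set (BondConfig (Fin n))),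
      (prodBernoulli r).real S = Λ.real ((fun U : Sym2 (Fin n) → ℝ => {i | U i ≤ (r i : ℝ)}) ⁻¹' S) := by
    intro r S
    rw [prodBernoulli_eq_map_labels r, map_measureReal_apply (hmeas r) MeasurableSet.of_discrete]
  -- pointwise: off the pull-back of `Z`, `η_w ∈ B ⇒ η_{w'} ∈ B'`
  have key : (fun U : Sym2 (Fin n) → ℝ => {i | U i ≤ (w i : ℝ)}) ⁻¹' B ⊆
      (fun U : Sym2 (Fin n) → ℝ => {i | U i ≤ (w' i : ℝ)}) ⁻¹' B' ∪
        (fun U : Sym2 (Fin n) → ℝ => {i | U i ≤ (w i : ℝ)}) ⁻¹' Z := by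
    intro U hU
    by_cases hUZ : U ∈ (fun U : Sym2 (Fin n) → ℝ => {i | U i ≤ (w i : ℝ)}) ⁻¹' Z
    · exact Or.inr hUZ
    refine Or.inl ?_
    set η : BondConfig (Fin n) := {i | U i ≤ (w i : ℝ)} with hη
    set η' : BondConfig (Fin n) := {i | U i ≤ (w' i : ℝ)} with hη'
    have hUB : η ∈ B := hU
    obtain ⟨h1, hlt⟩ := hUB
    -- `η ⊆ η'`
    have hsubset : η ⊆ η' := fun i (hi : U i ≤ (w i : ℝ)) =>
      hi.trans (Subtype.coe_le_coe.2 (hle i))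
    -- new edges lie inside `H`
    have hnewH : ∀ e, e ∈ η' → e ∉ η → ∀ u ∈ e, u ∈ H := by
      intro e he hne u hu
      refine hdiff e (fun hwe => hne ?_) u hu
      have he' : U e ≤ (w' e : ℝ) := he
      show U e ≤ (w e : ℝ)
      rw [hwe]; exact he'
    -- on `B`, the cluster of `o` avoids `H`
    have havoid : ∀ u ∈ H, ¬ (openGraph η).Reachable o u := by
      intro u hu hou
      exact hUZ (Set.mem_biUnion hu ⟨hou, hlt⟩)
    -- hence the cluster of `o` is the same in `η` and `η'`
    have hfrozen : ∀ x y, (openGraph η').Adj x y → ¬ (openGraph η).Adj x y →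
        ¬ (openGraph η).Reachable o x := by
      intro x y hxy hnxy
      rw [openGraph_adj] at hxy hnxy
      have hnot : s(x, y) ∉ η := fun hin => hnxy ⟨hin, hxy.2⟩
      exact havoid x (hnewH _ hxy.1 hnot x (Sym2.mem_mk_left x y))
    have hsame : ∀ a, η' ∈ openConn o a ↔ η ∈ openConn o a := by
      intro a
      constructor
      · intro h'
        obtain ⟨p⟩ := (show (openGraph η').Reachable o a from h')
        exact reachable_of_frozen hfrozen p SimpleGraph.Reachable.rfl
      · intro h'
        exact (show (openGraph η).Reachable o a from h').mono (openGraph_mono hsubset)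
    have hfilt : (A.filter fun a => η' ∈ openConn o a) = (A.filter fun a => η ∈ openConn o a) :=
      Finset.filter_congr fun a _ => hsame a
    show η' ∈ B'
    refine ⟨by rw [hfilt]; exact h1, ?_⟩
    rw [hfilt]
    exact lt_of_lt_of_le hlt (mul_le_mul_of_nonneg_left hENle hρ)
  rw [hrepr w B, hrepr w' B']
  calc Λ.real ((fun U : Sym2 (Fin n) → ℝ => {i | U i ≤ (w i : ℝ)}) ⁻¹' B)
      ≤ Λ.real ((fun U : Sym2 (Fin n) → ℝ => {i | U i ≤ (w' i : ℝ)}) ⁻¹' B' ∪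
          (fun U : Sym2 (Fin n) → ℝ => {i | U i ≤ (w i : ℝ)}) ⁻¹' Z) := measureReal_mono key
    _ ≤ Λ.real ((fun U : Sym2 (Fin n) → ℝ => {i | U i ≤ (w' i : ℝ)}) ⁻¹' B') +
          Λ.real ((fun U : Sym2 (Fin n) → ℝ => {i | U i ≤ (w i : ℝ)}) ⁻¹' Z) :=
        measureReal_union_le _ _
    _ = Λ.real ((fun U : Sym2 (Fin n) → ℝ => {i | U i ≤ (w' i : ℝ)}) ⁻¹' B') := by
        rw [← hrepr w Z, hZ0, add_zero]

/-! ## Heavy cloning -/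

/-- Gluing a new relay onto an old one keeps the pairwise cut budget: if `μ(v ↮ a) = 0` for some
`a ∈ A` and all cuts among distinct relays of `A` are `≤ t`, the same holds for `insert v A`. [folklore] -/
theorem pairCut_insert_le (w : Sym2 (Fin n) → unitInterval) (A : Finset (Fin n)) (v a : Fin n) (t : ℝ)
    (ht : 0 ≤ t) (ha : a ∈ A) (hglue : (prodBernoulli w).real (openConn v a)ᶜ = 0)
    (hpair : ∀ x ∈ A, ∀ y ∈ A, x ≠ y → (prodBernoulli w).real (openConn x y)ᶜ ≤ t) :
    ∀ x ∈ insert v A, ∀ y ∈ insert v A, x ≠ y → (prodBernoulli w).real (openConn x y)ᶜ ≤ t := by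
  classical
  set μ := prodBernoulli w with hμ
  -- cuts from `v` are at most cuts from `a`
  have hv : ∀ y ∈ A, μ.real (openConn v y)ᶜ ≤ t := by
    intro y hy
    by_cases hya : y = a
    · rw [hya, hglue]; exact ht
    calc μ.real (openConn v y)ᶜ ≤ μ.real ((openConn v a)ᶜ ∪ (openConn a y)ᶜ) :=
          measureReal_mono fun ω hω => by
            by_contra hcon
            simp only [Set.mem_union, Set.mem_compl_iff, not_or, not_not] at hcon
            exact hω ((show (openGraph ω).Reachable v a from hcon.1).trans hcon.2)
      _ ≤ μ.real (openConn v a)ᶜ + μ.real (openConn a y)ᶜ := measureReal_union_le _ _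
      _ ≤ 0 + t := by rw [hglue]; exact add_le_add le_rfl (hpair a ha y hy (fun h => hya h.symm))
      _ = t := zero_add t
  have hsymm : ∀ x y : Fin n, (openConn x y : Set (BondConfig (Fin n)))ᶜ = (openConn y x)ᶜ := by
    intro x y; ext ω
    simp only [Set.mem_compl_iff]
    exact not_congr ⟨fun h => (show (openGraph ω).Reachable x y from h).symm,
      fun h => (show (openGraph ω).Reachable y x from h).symm⟩
  intro x hx y hy hxy
  rcases Finset.mem_insert.1 hx with rfl | hxA
  · rcases Finset.mem_insert.1 hy with rfl | hyA
    · exact absurd rfl hxy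
    · exact hv y hyA
  · rcases Finset.mem_insert.1 hy with rfl | hyA
    · rw [hsymm]; exact hv x hxA
    · exact hpair x hxA y hyA hxy

/-- **Heavy cloning.**  If `a ∈ A` is HEAVY (`μ(o ↔ a, N < ρ EN) = 0`) and `v ∉ A` is almost surely glued
to `a` (`μ(v ↮ a) = 0`), then enlarging the relay set to `insert v A` does not decrease the lower-tail
mass: off a null set, on `B_ρ(A)` the observer misses `a`, hence `v`, so `N` is unchanged while `EN` grows
by `μ(o ↔ v)`. [folklore] -/
theorem lowerTail_heavyClone (w : Sym2 (Fin n) → unitInterval) (A : Finset (Fin n)) (o v a : Fin n)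
    (ρ : ℝ) (hρ : 0 ≤ ρ) (hv : v ∉ A)
    (hglue : (prodBernoulli w).real (openConn v a)ᶜ = 0)
    (hheavy : (prodBernoulli w).real (openConn o a ∩ {ω : BondConfig (Fin n) |
        ((A.filter fun a => ω ∈ openConn o a).card : ℝ) <
          ρ * ∑ a ∈ A, (prodBernoulli w).real (openConn o a)}) = 0) :
    (prodBernoulli w).real {ω : BondConfig (Fin n) |
        1 ≤ (A.filter fun a => ω ∈ openConn o a).card ∧
        ((A.filter fun a => ω ∈ openConn o a).card : ℝ) <
          ρ * ∑ a ∈ A, (prodBernoulli w).real (openConn o a)} ≤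
    (prodBernoulli w).real {ω : BondConfig (Fin n) |
        1 ≤ ((insert v A).filter fun a => ω ∈ openConn o a).card ∧
        (((insert v A).filter fun a => ω ∈ openConn o a).card : ℝ) <
          ρ * ∑ a ∈ insert v A, (prodBernoulli w).real (openConn o a)} := by
  classical
  set μ := prodBernoulli w with hμ
  set EN := ∑ a ∈ A, μ.real (openConn o a) with hEN
  have hEN' : ∑ a ∈ insert v A, μ.real (openConn o a) = μ.real (openConn o v) + EN :=
    Finset.sum_insert hv
  have hENle : EN ≤ ∑ a ∈ insert v A, μ.real (openConn o a) := by
    rw [hEN']; linarith [measureReal_nonneg (μ := μ) (s := openConn o v)]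
  set Z := (openConn v a)ᶜ ∪ (openConn o a ∩ {ω : BondConfig (Fin n) |
      ((A.filter fun a => ω ∈ openConn o a).card : ℝ) < ρ * EN}) with hZ
  have hZ0 : μ.real Z = 0 :=
    le_antisymm ((measureReal_union_le _ _).trans (by rw [hglue, hheavy, add_zero])) measureReal_nonneg
  have hsub : {ω : BondConfig (Fin n) | 1 ≤ (A.filter fun a => ω ∈ openConn o a).card ∧
        ((A.filter fun a => ω ∈ openConn o a).card : ℝ) < ρ * EN} ⊆
      {ω : BondConfig (Fin n) | 1 ≤ ((insert v A).filter fun a => ω ∈ openConn o a).card ∧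
        (((insert v A).filter fun a => ω ∈ openConn o a).card : ℝ) <
          ρ * ∑ a ∈ insert v A, μ.real (openConn o a)} ∪ Z := by
    intro ω hω
    by_cases hωZ : ω ∈ Z
    · exact Or.inr hωZ
    refine Or.inl ?_
    obtain ⟨h1, hlt⟩ := hω
    have hva : ω ∈ openConn v a := by
      by_contra hcon; exact hωZ (Or.inl hcon)
    have hoa : ω ∉ openConn o a := fun hcon => hωZ (Or.inr ⟨hcon, hlt⟩)
    have hov : ω ∉ openConn o v := fun hcon =>
      hoa ((show (openGraph ω).Reachable o v from hcon).trans hva)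
    have hfilt : ((insert v A).filter fun a => ω ∈ openConn o a) =
        (A.filter fun a => ω ∈ openConn o a) := by
      rw [Finset.filter_insert, if_neg hov]
    refine ⟨by rw [hfilt]; exact h1, ?_⟩
    rw [hfilt]
    exact lt_of_lt_of_le hlt (mul_le_mul_of_nonneg_left hENle hρ)
  calc μ.real {ω : BondConfig (Fin n) | 1 ≤ (A.filter fun a => ω ∈ openConn o a).card ∧
          ((A.filter fun a => ω ∈ openConn o a).card : ℝ) < ρ * EN}
      ≤ μ.real ({ω : BondConfig (Fin n) | 1 ≤ ((insert v A).filter fun a => ω ∈ openConn o a).card ∧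
          (((insert v A).filter fun a => ω ∈ openConn o a).card : ℝ) <
            ρ * ∑ a ∈ insert v A, μ.real (openConn o a)} ∪ Z) := measureReal_mono hsub
    _ ≤ μ.real {ω : BondConfig (Fin n) | 1 ≤ ((insert v A).filter fun a => ω ∈ openConn o a).card ∧
          (((insert v A).filter fun a => ω ∈ openConn o a).card : ℝ) <
            ρ * ∑ a ∈ insert v A, μ.real (openConn o a)} + μ.real Z := measureReal_union_le _ _
    _ = _ := by rw [hZ0, add_zero]

end OneCutSymm

end Summit.CriticalPhenomena.PercolationContinuityZ3.Theorems

end
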